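import Mathlib
import Summits.Ventures.PercRepro.PuncturedLYMMixT1Q4Table1
import Summits.Ventures.PercRepro.PuncturedLYMMixT1Q4Table2
import Summits.Ventures.PercRepro.PuncturedLYMMixT1Q4Rows1

/-!
# PercRepro — (SP) FOR `1` PAIRWISE DISJOINT TRIPLES AND `4` PAIRWISE DISJOINT QUADRUPLES AT LEVEL `4`: THE ROW IDENTITIES, ASSEMBLED
(p10, gen 41)

`row_check`: the row identity of every class (`mass ≤ 4`, the touched bounds `≤ 1` / `≤ 4`), by nested `interval_cases` over the class counts.  Nothing here asserts (SP).
-/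

namespace PercRepro.PuncturedLYM.Split.TypeLift.MixT1Q4

/-- The row identity of every class, in one statement. -/
theorem row_check (n : ℚ) (hd : den n ≠ 0) (hPc : Pc n ≠ 0) (c31 c32 c41 c42 c43 : ℕ)
    (h : c31 + 2 * c32 + c41 + 2 * c42 + 3 * c43 ≤ 4) (hA : c31 + c32 ≤ 1) (hB : c41 + c42 + c43 ≤ 4) :
    3 * ((1 : ℚ) - ((c31 : ℚ) + c32)) * raw n c31 c32 c41 c42 c43 0 + 2 * (c31 : ℚ) * raw n c31 c32 c41 c42 c43 1 + (c32 : ℚ) / 3 + 4 * ((4 : ℚ) - ((c41 : ℚ) + c42 + c43)) * raw n c31 c32 c41 c42 c43 3 + 3 * (c41 : ℚ) * raw n c31 c32 c41 c42 c43 4 + 2 * (c42 : ℚ) * raw n c31 c32 c41 c42 c43 5 + (c43 : ℚ) / 4 +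
      (n - 19 - ((4 : ℚ) - c31 - 2 * c32 - c41 - 2 * c42 - 3 * c43)) * raw n c31 c32 c41 c42 c43 7 = Yc n / Pc n := by
  have hb5 : c43 ≤ 1 := by omega
  interval_cases c43
  · have hb4 : c42 ≤ 2 := by omega
    interval_cases c42
    · have hb3 : c41 ≤ 4 := by omega
      interval_cases c41
      · have hb2 : c32 ≤ 1 := by omega
        interval_cases c32
        · have hb1 : c31 ≤ 1 := by omega
          interval_cases c31
          · push_cast
            linear_combination row_00000 n hd hPc
          · push_cast
            linear_combination row_10000 n hd hPc
        · have hb1 : c31 ≤ 0 := by omega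
          interval_cases c31
          · push_cast
            linear_combination row_01000 n hd hPc
      · have hb2 : c32 ≤ 1 := by omega
        interval_cases c32
        · have hb1 : c31 ≤ 1 := by omega
          interval_cases c31
          · push_cast
            linear_combination row_00100 n hd hPc
          · push_cast
            linear_combination row_10100 n hd hPc
        · have hb1 : c31 ≤ 0 := by omega
          interval_cases c31
          · push_cast
            linear_combination row_01100 n hd hPc
      · have hb2 : c32 ≤ 1 := by omega
        interval_cases c32
        · have hb1 : c31 ≤ 1 := by omega
          interval_cases c31
          · push_cast
            linear_combination row_00200 n hd hPc
          · push_cast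
            linear_combination row_10200 n hd hPc
        · have hb1 : c31 ≤ 0 := by omega
          interval_cases c31
          · push_cast
            linear_combination row_01200 n hd hPc
      · have hb2 : c32 ≤ 0 := by omega
        interval_cases c32
        · have hb1 : c31 ≤ 1 := by omega
          interval_cases c31
          · push_cast
            linear_combination row_00300 n hd hPc
          · push_cast
            linear_combination row_10300 n hd hPc
      · have hb2 : c32 ≤ 0 := by omega
        interval_cases c32
        · have hb1 : c31 ≤ 0 := by omega
          interval_cases c31
          · push_cast
            linear_combination row_00400 n hd hPc
    · have hb3 : c41 ≤ 2 := by omega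
      interval_cases c41
      · have hb2 : c32 ≤ 1 := by omega
        interval_cases c32
        · have hb1 : c31 ≤ 1 := by omega
          interval_cases c31
          · push_cast
            linear_combination row_00010 n hd hPc
          · push_cast
            linear_combination row_10010 n hd hPc
        · have hb1 : c31 ≤ 0 := by omega
          interval_cases c31
          · push_cast
            linear_combination row_01010 n hd hPc
      · have hb2 : c32 ≤ 0 := by omega
        interval_cases c32
        · have hb1 : c31 ≤ 1 := by omega
          interval_cases c31
          · push_cast
            linear_combination row_00110 n hd hPc
          · push_cast
            linear_combination row_10110 n hd hPc
      · have hb2 : c32 ≤ 0 := by omega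
        interval_cases c32
        · have hb1 : c31 ≤ 0 := by omega
          interval_cases c31
          · push_cast
            linear_combination row_00210 n hd hPc
    · have hb3 : c41 ≤ 0 := by omega
      interval_cases c41
      · have hb2 : c32 ≤ 0 := by omega
        interval_cases c32
        · have hb1 : c31 ≤ 0 := by omega
          interval_cases c31
          · push_cast
            linear_combination row_00020 n hd hPc
  · have hb4 : c42 ≤ 0 := by omega
    interval_cases c42
    · have hb3 : c41 ≤ 1 := by omega
      interval_cases c41
      · have hb2 : c32 ≤ 0 := by omega
        interval_cases c32
        · have hb1 : c31 ≤ 1 := by omega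
          interval_cases c31
          · push_cast
            linear_combination row_00001 n hd hPc
          · push_cast
            linear_combination row_10001 n hd hPc
      · have hb2 : c32 ≤ 0 := by omega
        interval_cases c32
        · have hb1 : c31 ≤ 0 := by omega
          interval_cases c31
          · push_cast
            linear_combination row_00101 n hd hPc

end PercRepro.PuncturedLYM.Split.TypeLift.MixT1Q4
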